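import Mathlib
import HarnessLib
import Summits.HubbardSuperconductivity.HubbardSuperconductivity.Theorems.KLProgrammeKLRegimeWickSmearingDefect
import Literature.MathematicalPhysics.QuantumLattice.GrassmannKernelMeanValue

/-!
# Route `KLProgramme` — ENGINE child gen 8 (stmt-HubbardSuperconductivity-20437 `KLRegimeEngineV17F2`), skeleton v2 class #5 «(S)-transfer» (plan g17 (R47h)):
# the `𝒲₆⊗𝒲₂` (S62) integrand IS a tadpole of the sextic — `Σ_{kσ} c(kσ)·𝒱₆(W)(ψ̂⁺_{kσ}, ψ̂⁻_{kσ}, Z) = −(βL²)²·𝒱₄(Δ_{normalCovariance c} W)(Z)`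

Cell gate-hubbard-kl, seat hubbard-kl-p1 (g11; text owner of class #5).  E2-FAMILY-NOTE §4 (Σ): the one remaining n-uniform class inside each Wick tower of the class-#5
producer is S62 = the Σ-dressing of the hard line sandwiched by the sextic tree, `S₆₂ = 2(c₆c₂)⁻¹Σ_{pσ} ℓ₁ℓ₂(p)·𝒱₆(𝒲)(ψ̂⁺_{pσ}, ψ̂⁻_{pσ}, Z)·Σ^W(p,σ)` (`bubbleSum_sixTwo_pairLabels`,
p503245).  By the one-loop formula `vertexFn_grassmannLaplacian_normalCovariance'` (p536297) and the antisymmetry of the kernels (a 6-cycle of the legs, sign `−1`) this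
loop sum is EXACTLY a Laplacian of `W` by the normal covariance with the composite symbol `c = ℓ₁ℓ₂·Σ^W` — i.e. (Salmhofer 1998 Prop. 1: `Δ_E G = ∂_ε e^{Δ_{εE}} G|₀`) the
DERIVATIVE of the smeared family `ε ↦ 𝒱₄(e^{Δ_{εE}}W)` in the covariance direction `E = normalCovariance c`:

* `vertexFn_six_pairFirst_eq_neg` — `𝒱₆(W)(ψ̂⁺_{kσ}, ψ̂⁻_{kσ}, Z₀, Z₁, Z₂, Z₃) = −𝒱₆(W)(Z₀, Z₁, Z₂, Z₃, ψ̂⁻_{kσ}, ψ̂⁺_{kσ})` (`kernel_comp_perm`, the 6-cycle);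
* **`sum_vertexFn_six_pairFirst_eq`** — `Σ_{kσ} c(kσ)·𝒱₆(W)(ψ̂⁺_{kσ}, ψ̂⁻_{kσ}, Z) = −(βL²)²·𝒱₄(Δ_{normalCovariance c}W)(Z)` (`0 ≠ β`).

So the S62 class of a tower whose carrier is a member of the class-#5 family is a covariance-direction derivative of that same family (ladder-shaped exactly when the family
is resummation-shaped in the covariance); exact algebra, nothing about sizes or superconductivity is asserted.  0 kit.
-/

noncomputable section

namespace Summit.HubbardSuperconductivity.HubbardSuperconductivity.Theorems.KLRegimeWick

set_option linter.dupNamespace false -- summit = problem name (single-conjunct summit), D-0017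

open Literature.MathematicalPhysics.QuantumLattice GrassmannAlgebra Finset Matrix
open Literature.Probability.LatticeModels Summit.HubbardSuperconductivity.HubbardSuperconductivity.Theorems.KLProgrammeLegKernels
open Summit.HubbardSuperconductivity.HubbardSuperconductivity.Theorems.KLRegimeSplit

section Model

variable (L M : ℕ) [NeZero L] {β : ℝ}

/-- The tadpole legs moved from the front to the back (and transposed): a 6-cycle of the legs, sign `−1`:
`𝒱₆(W)(ψ̂⁺_{kσ}, ψ̂⁻_{kσ}, Z₀, Z₁, Z₂, Z₃) = −𝒱₆(W)(Z₀, Z₁, Z₂, Z₃, ψ̂⁻_{kσ}, ψ̂⁺_{kσ})`. -/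
theorem vertexFn_six_pairFirst_eq_neg (W : HubbardGrassmann L M) (A B Z₀ Z₁ Z₂ Z₃ : HubbardFieldIdx L M) :
    vertexFn L M β W 6 ![A, B, Z₀, Z₁, Z₂, Z₃] = -vertexFn L M β W 6 ![Z₀, Z₁, Z₂, Z₃, B, A] := by
  let σ : Equiv.Perm (Fin 6) := ⟨![2, 3, 4, 5, 1, 0], ![5, 4, 0, 1, 2, 3], by decide, by decide⟩
  have hσ : Equiv.Perm.sign σ = -1 := by decide
  have hW : (![Z₀, Z₁, Z₂, Z₃, B, A] : Fin 6 → HubbardFieldIdx L M) = ![A, B, Z₀, Z₁, Z₂, Z₃] ∘ σ := by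
    funext i; fin_cases i <;> rfl
  rw [vertexFn_def, vertexFn_def, hW, Literature.MathematicalPhysics.QuantumLattice.kernel_comp_perm, hσ]
  push_cast
  ring

/-- The appended form of the legs used by the one-loop formula: `snoc (snoc ![Z₀,Z₁,Z₂,Z₃] B) A = ![Z₀,Z₁,Z₂,Z₃,B,A]`. -/
theorem snoc_snoc_vec4 {α : Type*} (Z₀ Z₁ Z₂ Z₃ B A : α) :
    (Fin.snoc (Fin.snoc (![Z₀, Z₁, Z₂, Z₃] : Fin 4 → α) B : Fin 5 → α) A : Fin 6 → α) = ![Z₀, Z₁, Z₂, Z₃, B, A] := by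
  funext i; fin_cases i <;> rfl

/-- **`sum_vertexFn_six_pairFirst_eq` — the S62 integrand is a tadpole of the sextic, i.e. a Laplacian of `W`** (`0 ≠ β`):
`Σ_{kσ} c(kσ)·𝒱₆(W)(ψ̂⁺_{kσ}, ψ̂⁻_{kσ}, Z₀, Z₁, Z₂, Z₃) = −(βL²)²·𝒱₄(Δ_{normalCovariance c} W)(Z₀, Z₁, Z₂, Z₃)` — with `c = ℓ₁ℓ₂·Σ^W` this is the loop sum of
`bubbleSum_sixTwo_pairLabels`; with `E = normalCovariance c`, `Δ_E W = ∂_ε e^{Δ_{εE}} W|_{ε=0}` (Salmhofer Prop. 1, `hasCoeffDerivAt_gaussConv_apply_of_eq_zero`):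
the covariance-direction derivative of the smeared family of class #5. -/
theorem sum_vertexFn_six_pairFirst_eq (hβ : β ≠ 0) (c : FreqMomentum L M × Fin 2 → ℂ) (W : HubbardGrassmann L M) (Z₀ Z₁ Z₂ Z₃ : HubbardFieldIdx L M) :
    ∑ p : FreqMomentum L M × Fin 2, c p * vertexFn L M β W 6 ![((p, 0) : HubbardFieldIdx L M), (p, 1), Z₀, Z₁, Z₂, Z₃] =
      -((((β * (L : ℝ) ^ 2) ^ 2 : ℝ) : ℂ)) * vertexFn L M β (grassmannLaplacian ℂ (normalCovariance L M c) W) 4 ![Z₀, Z₁, Z₂, Z₃] := by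
  have hL : (L : ℂ) ≠ 0 := Nat.cast_ne_zero.mpr (NeZero.ne L)
  have hβ' : (β : ℂ) ≠ 0 := Complex.ofReal_ne_zero.mpr hβ
  have hT : ((((β * (L : ℝ) ^ 2) ^ 2 : ℝ) : ℂ)) ≠ 0 := by push_cast; exact pow_ne_zero _ (mul_ne_zero hβ' (pow_ne_zero _ hL))
  rw [vertexFn_grassmannLaplacian_normalCovariance' L M hβ c W (by norm_num : 0 < 4) ![Z₀, Z₁, Z₂, Z₃], ← mul_assoc, neg_mul, mul_inv_cancel₀ hT,
    neg_one_mul, ← sum_neg_distrib]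
  refine sum_congr rfl fun p _ => ?_
  rw [snoc_snoc_vec4, vertexFn_six_pairFirst_eq_neg L M W ((p, 0) : HubbardFieldIdx L M) (p, 1) Z₀ Z₁ Z₂ Z₃, mul_neg]

end Model

/-! ## §2 (APPEND p1 g11) The derivative form: the S62 loop sum is `−(βL²)²·∂_ε 𝒱₄(e^{Δ_{εE}}W)|_{ε=0}`, `E = normalCovariance c` -/

section Deriv

variable (L M : ℕ) [NeZero L] {β : ℝ}

/-- **The vertex functions of the straight smearing path are differentiable at `0` with derivative the Laplacian's** (Salmhofer's Prop. 1 at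
`ε = 0`: `hasCoeffDerivAt_gaussConv_apply_of_eq_zero` with `B ε = ε • E`, `B 0 = 0`, `B′ = E`, read through `hasDerivAt_kernel_of_hasCoeffDerivAt`):
`∂_ε 𝒱_m(e^{Δ_{εE}}G)(Z)|_{ε=0} = 𝒱_m(Δ_E G)(Z)`. -/
theorem hasDerivAt_vertexFn_gaussConv_smul (E : Matrix (HubbardFieldIdx L M) (HubbardFieldIdx L M) ℂ) (G : HubbardGrassmann L M) (m : ℕ)
    (Z : Fin m → HubbardFieldIdx L M) :
    HasDerivAt (fun ε : ℝ => vertexFn L M β (gaussConv ℂ (ε • E) G) m Z) (vertexFn L M β (grassmannLaplacian ℂ E G) m Z) 0 := by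
  letI : LinearOrder (HubbardFieldIdx L M) := LinearOrder.lift' (Fintype.equivFin _) (Fintype.equivFin _).injective
  have hB : ∀ X Y : HubbardFieldIdx L M, HasDerivAt (fun ε : ℝ => (ε • E) X Y) (E X Y) 0 := fun X Y => by
    have h := (hasDerivAt_id (0 : ℝ)).smul_const (E X Y)
    simp only [Matrix.smul_apply, one_smul] at h ⊢
    exact h
  have hcoeff : GrassmannAlgebra.HasCoeffDerivAt (fun ε : ℝ => gaussConv ℂ (ε • E) G) (grassmannLaplacian ℂ E G) 0 :=
    hasCoeffDerivAt_gaussConv_apply_of_eq_zero (B := fun ε : ℝ => ε • E) hB (zero_smul ℝ E) G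
  have h := (hasDerivAt_kernel_of_hasCoeffDerivAt hcoeff m Z).const_mul ((((m.factorial : ℝ) * (β * (L : ℝ) ^ 2) ^ (m - 1) : ℝ) : ℂ))
  simp only [vertexFn_def]
  exact h

/-- **`hasDerivAt_vertexFn_gaussConv_smul_normalCovariance` — the S62 loop sum as a COVARIANCE-DIRECTION DERIVATIVE** (`0 ≠ β`): with `E = normalCovariance c`,
`∂_ε 𝒱₄(e^{Δ_{εE}}W)(Z₀,Z₁,Z₂,Z₃)|_{ε=0} = −(βL²)⁻²·Σ_{kσ} c(kσ)·𝒱₆(W)(ψ̂⁺_{kσ}, ψ̂⁻_{kσ}, Z₀, Z₁, Z₂, Z₃)` — the `𝒲₆⊗𝒲₂` class of a tower whose carrier `W` is a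
member of the class-#5 smeared family is the derivative of that family in the direction of the composite line (E2-FAMILY-NOTE §4 (Σ)). -/
theorem hasDerivAt_vertexFn_gaussConv_smul_normalCovariance (hβ : β ≠ 0) (c : FreqMomentum L M × Fin 2 → ℂ) (W : HubbardGrassmann L M)
    (Z₀ Z₁ Z₂ Z₃ : HubbardFieldIdx L M) :
    HasDerivAt (fun ε : ℝ => vertexFn L M β (gaussConv ℂ (ε • normalCovariance L M c) W) 4 ![Z₀, Z₁, Z₂, Z₃])
      (-((((β * (L : ℝ) ^ 2) ^ 2 : ℝ) : ℂ))⁻¹ *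
        ∑ p : FreqMomentum L M × Fin 2, c p * vertexFn L M β W 6 ![((p, 0) : HubbardFieldIdx L M), (p, 1), Z₀, Z₁, Z₂, Z₃]) 0 := by
  have hL : (L : ℂ) ≠ 0 := Nat.cast_ne_zero.mpr (NeZero.ne L)
  have hβ' : (β : ℂ) ≠ 0 := Complex.ofReal_ne_zero.mpr hβ
  have hT : ((((β * (L : ℝ) ^ 2) ^ 2 : ℝ) : ℂ)) ≠ 0 := by push_cast; exact pow_ne_zero _ (mul_ne_zero hβ' (pow_ne_zero _ hL))
  have h := hasDerivAt_vertexFn_gaussConv_smul L M (β := β) (normalCovariance L M c) W 4 ![Z₀, Z₁, Z₂, Z₃]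
  refine h.congr_deriv ?_
  rw [sum_vertexFn_six_pairFirst_eq L M hβ c W Z₀ Z₁ Z₂ Z₃]
  field_simp

end Deriv

end Summit.HubbardSuperconductivity.HubbardSuperconductivity.Theorems.KLRegimeWick

end
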